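import Summits.CriticalPhenomena.PercolationContinuityZ3.Theorems.PercNearOneGluingNoHeavyLowerTailEG3Wrap
import Summits.CriticalPhenomena.PercolationContinuityZ3.Theorems.PercNearOneGluingNoHeavyLowerTailCertRowsLinear
import HarnessLib

/-!
# `NoHeavyLowerTail` (stmt-CriticalPhenomena-4575) — certificate machine add-on: the EG₃ target and the regime
# hypotheses of product-form certificates, read back as measures

Support file (new-inequality factory, all-graph proof seat `prim-ineq-prove-4`; `--supports stmt-CriticalPhenomena-4575`).
Bookkeeping definition `FEG3` (the EG₃ target as `PTerm` data, exactly as emitted by this seat's converter), no named facts,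
no sorries.

A product-form certificate (tree `…CertProd`, `…CertProdHyp`) concludes `0 ≤ M₀ · pval x F` at the cell law `x`; its linear
hypothesis rows appear as inequalities `linEval x (cellsOf F_lo) ≤ linEval x (cellsOf F_hi)`.  This file translates, once and
for all, the EG₃ instances of these back to probabilities (terminals `0 = o`, `1,2,3 = a₁,a₂,a₃` worst-first, `4 = b`):
* `linEval_cellsOf` — `linEval x (cellsOf F) = μ(F.set v)`;
* `set_notConn'`, `set_conn'`, `set_tr1`, `set_tr23` — the formula events `{i↮4}`, `{i↔4}`, `{b↔a₁ only}`, `{b↔a₂,a₃, b↮a₁}`;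
* `FEG3`, `pval_FEG3` — the target `F = μ{a₁↮b} − μ({o↮b} ∩ {o↔A})`: `pval x FEG3 = dist w v 1 − μ(eg3Event v)`;
* `conn_le_of_dist_le` — `dⱼ ≤ dᵢ ⇒ μ{aᵢ↔b} ≤ μ{aⱼ↔b}`;
* `eg3_of_m0F` — `0 ≤ M₀·pval x FEG3` and `M₀ > 0` give `μ(eg3Event v) ≤ dist w v 1`.
-/

noncomputable section

namespace Summit.CriticalPhenomena.PercolationContinuityZ3.Theorems

open MeasureTheory Set Literature.Probability.Percolation
open Literature.Probability.LatticeModels (prodBernoulli)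
open scoped Classical BigOperators
open PatternCells CertCheck CertCells

namespace EG3Target

variable {n : ℕ}

/-- `linEval` of the cells of a formula is the probability of its event. [folklore] -/
theorem linEval_cellsOf (w : Sym2 (Fin n) → unitInterval) (v : Fin 5 → Fin n) (F : Formula) :
    linEval (fun m => (prodBernoulli w).real (Cell v m)) (cellsOf F) = (prodBernoulli w).real (F.set v) :=
  (measureReal_set_eq_linEval _ v F).symm

/-- `{i ↮ 4}` as a formula event. [folklore] -/
theorem set_notConn' (v : Fin 5 → Fin n) (i : Fin 5) :
    Formula.set v [[(i, 4, false)]] = (openConn (v i) (v 4) : Set (BondConfig (Fin n)))ᶜ := set_notConn v i 4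

/-- `{i ↔ j}` as a formula event. [folklore] -/
theorem set_conn' (v : Fin 5 → Fin n) (i j : Fin 5) :
    Formula.set v [[(i, j, true)]] = (openConn (v i) (v j) : Set (BondConfig (Fin n))) := by
  ext ω
  rw [mem_set_single]
  simp only [List.mem_singleton, forall_eq, openConn, Set.mem_setOf_eq]
  unfold Lit.holds
  simp only [iff_true]

/-- The trace event `{b ↔ a₁, b ↮ a₂, b ↮ a₃}` as a formula event (the converter's rendering of `('tr', 4, A, (1,))`). [folklore] -/
theorem set_tr1 (v : Fin 5 → Fin n) :
    Formula.set v [[(1, 4, true), (2, 4, false), (3, 4, false)]] =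
      (openConn (v 4) (v 1) : Set (BondConfig (Fin n))) ∩ (openConn (v 4) (v 2))ᶜ ∩ (openConn (v 4) (v 3))ᶜ := by
  ext ω
  rw [mem_set_single]
  simp only [List.mem_cons, List.not_mem_nil, or_false, forall_eq_or_imp, forall_eq, Set.mem_inter_iff,
    Set.mem_compl_iff, openConn, Set.mem_setOf_eq]
  unfold Lit.holds
  simp only [iff_true, Bool.false_eq_true, iff_false]
  constructor
  · rintro ⟨h1, h2, h3⟩
    exact ⟨⟨h1.symm, fun h => h2 h.symm⟩, fun h => h3 h.symm⟩
  · rintro ⟨⟨h1, h2⟩, h3⟩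
    exact ⟨h1.symm, fun h => h2 h.symm, fun h => h3 h.symm⟩

/-- The trace event `{b ↮ a₁, b ↔ a₂, b ↔ a₃}` as a formula event (rendering of `('tr', 4, A, (2,3))`). [folklore] -/
theorem set_tr23 (v : Fin 5 → Fin n) :
    Formula.set v [[(1, 4, false), (2, 4, true), (3, 4, true)]] =
      (openConn (v 4) (v 2) : Set (BondConfig (Fin n))) ∩ openConn (v 4) (v 3) ∩ (openConn (v 4) (v 1))ᶜ := by
  ext ω
  rw [mem_set_single]
  simp only [List.mem_cons, List.not_mem_nil, or_false, forall_eq_or_imp, forall_eq, Set.mem_inter_iff,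
    Set.mem_compl_iff, openConn, Set.mem_setOf_eq]
  unfold Lit.holds
  simp only [iff_true, Bool.false_eq_true, iff_false]
  constructor
  · rintro ⟨h1, h2, h3⟩
    exact ⟨⟨h2.symm, h3.symm⟩, fun h => h1 h.symm⟩
  · rintro ⟨⟨h2, h3⟩, h1⟩
    exact ⟨fun h => h1 h.symm, h2.symm, h3.symm⟩

/-- The EG₃ target as product-form data: `+ μ{a₁↮b} − μ({o↔a₁ ∨ o↔a₂ ∨ o↔a₃} ∧ {o↮b})`. [folklore] -/
def FEG3 : List PTerm :=
  [⟨[cellsOf [[(1, 4, false)]]], 1, true⟩,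
   ⟨[cellsOf [[(0, 1, true), (0, 4, false)], [(0, 2, true), (0, 4, false)], [(0, 3, true), (0, 4, false)]]], 1, false⟩]

/-- The event of the second target factor is `eg3Event`. [folklore] -/
theorem set_eg3Formula (v : Fin 5 → Fin n) :
    Formula.set v [[(0, 1, true), (0, 4, false)], [(0, 2, true), (0, 4, false)], [(0, 3, true), (0, 4, false)]] =
      EG3Wrap.eg3Event v := by
  ext ω
  rw [mem_set_cons, mem_set_cons, mem_set_single]
  unfold Lit.holds
  simp only [List.mem_cons, List.not_mem_nil, or_false, forall_eq_or_imp, forall_eq, iff_true, Bool.false_eq_true,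
    iff_false, EG3Wrap.eg3Event, Set.mem_inter_iff, Set.mem_compl_iff, Set.mem_union, openConn, Set.mem_setOf_eq]
  tauto

/-- **The target read back**: `pval x FEG3 = dist w v 1 − μ(eg3Event v)`. [folklore] -/
theorem pval_FEG3 (w : Sym2 (Fin n) → unitInterval) (v : Fin 5 → Fin n) :
    pval (fun m => (prodBernoulli w).real (Cell v m)) FEG3 = EG3Wrap.dist w v 1 - (prodBernoulli w).real (EG3Wrap.eg3Event v) := by
  simp only [pval, FEG3, prodEval, List.map_cons, List.map_nil, List.prod_cons, List.prod_nil, List.sum_cons, List.sum_nil,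
    linEval_cellsOf, set_notConn', set_eg3Formula, EG3Wrap.dist, ite_true]
  simp
  ring

/-- `dⱼ ≤ dᵢ` in connection form: `μ{aᵢ ↔ b} ≤ μ{aⱼ ↔ b}`. [folklore] -/
theorem conn_le_of_dist_le (w : Sym2 (Fin n) → unitInterval) (v : Fin 5 → Fin n) (i j : Fin 5)
    (h : EG3Wrap.dist w v j ≤ EG3Wrap.dist w v i) :
    (prodBernoulli w).real (openConn (v i) (v 4)) ≤ (prodBernoulli w).real (openConn (v j) (v 4)) := by
  have hi := measureReal_add_measureReal_compl (μ := prodBernoulli w)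
    (s := (openConn (v i) (v 4) : Set (BondConfig (Fin n)))) MeasurableSet.of_discrete
  have hj := measureReal_add_measureReal_compl (μ := prodBernoulli w)
    (s := (openConn (v j) (v 4) : Set (BondConfig (Fin n)))) MeasurableSet.of_discrete
  simp only [EG3Wrap.dist] at h
  rw [probReal_univ] at hi hj
  linarith

/-- An order hypothesis of the certificate (`linEval` form of `μ{aⱼ↮b} ≤ μ{aᵢ↮b}`) from the sink distances. [folklore] -/
theorem linHyp_notConn (w : Sym2 (Fin n) → unitInterval) (v : Fin 5 → Fin n) (i j : Fin 5)
    (h : EG3Wrap.dist w v j ≤ EG3Wrap.dist w v i) :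
    linEval (fun m => (prodBernoulli w).real (Cell v m)) (cellsOf [[(j, 4, false)]]) ≤
      linEval (fun m => (prodBernoulli w).real (Cell v m)) (cellsOf [[(i, 4, false)]]) := by
  rw [linEval_cellsOf, linEval_cellsOf, set_notConn', set_notConn']
  exact h

/-- The `KO`-regime hypothesis `hKN` in `linEval` form. [folklore] -/
theorem linHyp_KN (w : Sym2 (Fin n) → unitInterval) (v : Fin 5 → Fin n)
    (h : (prodBernoulli w).real (openConn (v 4) (v 2) ∩ openConn (v 4) (v 3) ∩ (openConn (v 4) (v 1))ᶜ) ≤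
      (prodBernoulli w).real (openConn (v 4) (v 1) ∩ (openConn (v 4) (v 2))ᶜ ∩ (openConn (v 4) (v 3))ᶜ)) :
    linEval (fun m => (prodBernoulli w).real (Cell v m)) (cellsOf [[(1, 4, false), (2, 4, true), (3, 4, true)]]) ≤
      linEval (fun m => (prodBernoulli w).real (Cell v m)) (cellsOf [[(1, 4, true), (2, 4, false), (3, 4, false)]]) := by
  rw [linEval_cellsOf, linEval_cellsOf, set_tr1, set_tr23]
  exact h

/-- The `KO`-regime hypothesis `hObs` in `linEval` form. [folklore] -/
theorem linHyp_Obs (w : Sym2 (Fin n) → unitInterval) (v : Fin 5 → Fin n)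
    (h : EG3Wrap.dist w v 1 ≤ (prodBernoulli w).real (openConn (v 0) (v 4) : Set (BondConfig (Fin n)))ᶜ) :
    linEval (fun m => (prodBernoulli w).real (Cell v m)) (cellsOf [[(1, 4, false)]]) ≤
      linEval (fun m => (prodBernoulli w).real (Cell v m)) (cellsOf [[(0, 4, false)]]) := by
  rw [linEval_cellsOf, linEval_cellsOf, set_notConn', set_notConn']
  exact h

/-- **From a certificate to EG₃ at one placement**: `0 ≤ M₀ · pval x FEG3` and `M₀ > 0` give `μ(eg3Event v) ≤ dist w v 1`.
[folklore] -/
theorem eg3_of_m0F (w : Sym2 (Fin n) → unitInterval) (v : Fin 5 → Fin n) (M0 : List (List (List ℕ) × ℕ))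
    (hMF : 0 ≤ pM0val (fun m => (prodBernoulli w).real (Cell v m)) M0 * pval (fun m => (prodBernoulli w).real (Cell v m)) FEG3)
    (hM : 0 < pM0val (fun m => (prodBernoulli w).real (Cell v m)) M0) :
    (prodBernoulli w).real (EG3Wrap.eg3Event v) ≤ EG3Wrap.dist w v 1 := by
  have h := pval_nonneg_of_pos _ M0 FEG3 hMF hM
  rw [pval_FEG3] at h
  linarith

end EG3Target

end Summit.CriticalPhenomena.PercolationContinuityZ3.Theorems

end
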